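import Literature.NumberTheory.PAdicHodge.TatePairingPointOfKTwo
import Literature.NumberTheory.PAdicHodge.LegendreResolutionCoordinates
import Literature.NumberTheory.EllipticCurves.TateModuleContinuityProofs
import Literature.NumberTheory.EllipticCurves.TateModuleFreeProofs
import HarnessLib

/-!
# Kato's reciprocity law modulo (K₂) in BASIS FORM: the `X₂`-membership of TWO elements `x̃(v₀)`, `x̃(v₁)`

Topic `Literature/NumberTheory/PAdicHodge`; THEOREMS ONLY (no definition, no named fact, no instance, no `sorry`). The capstone
`TatePairingPointOfKTwo.exists_const_tatePairingPoint_eq_neg_trace_of_KTwo` (p743661) takes (K₂) in COCHAIN form — `p^N x̃(η σ) ∈ X⁰₂ + Fil²`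
for every `σ`, `p`-adically small near `1` (hypotheses `hX`, `hXsmall` of `RecognitionFromTeichLog`) — for the rescaled Legendre resolution
`x̃(a) = c_L⁻¹ Pη(a) b_ω − Pω(a) c_L⁻¹ b_η`. `LegendreResolutionCoordinates` (p742437) reduces both to the membership on a spanning family with
continuous `ℤ_p`-coordinates of `η` vanishing at `1`. This file supplies the coordinates and states the capstone with (K₂) in the BASIS FORM
of memo `Summits/BirchSwinnertonDyer/BirchSwinnertonDyer/Cruxes/StarredOptimalManinUnitFiveSeven/Lines/kato-lever-K3-legendre.md` §5
(`KTwoMembership`): for a `ℤ_p`-basis `(vᵢ)` of `T_pW`, **`p^N x̃(vᵢ) ∈ X⁰₂ + Fil²` for each `i`** — finitely many elements of `B_dR⁺`.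

* §1 `exists_continuous_coordinates` — for ANY `W/K₀`, `K₀ ⊆ F`, a `ℤ_p`-basis `b` of `T_pW` and a continuous crossed homomorphism
  `η : Γ_F → T_pW|_{Γ_F}`: the coordinates `cᵢ = b.coord i ∘ η` are continuous (`T_pW` carries its `ℤ_p`-module topology,
  `TateModule.isModuleTopology` + `module_finite_tateModule_holds`; Mathlib `IsModuleTopology.continuous_of_linearMap`), vanish at `1`
  (`contOneCocycles.apply_one`) and `η σ = Σᵢ cᵢ(σ) vᵢ` (`Basis.sum_repr`).
* §2 ★★ `exists_const_tatePairingPoint_eq_neg_trace_of_KTwoBasis` — the capstone at `F = K_v` with (K₂) replaced by its basis form: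
  ONE pair `(c_L ≠ 0, c)` such that for every `η`, `P` (with a `T`-adic Kummer cocycle `κ` — tree, `LocalTatePairingKummerTadic`), integrating pair
  `(b_ω, b_η)` with `θ(b_ω) = ι(c_P)`, every `N` and every `ℤ_p`-basis `b`: `(∀ i, IsTeichLog 2 (p^N x̃(b i))) ⟹ ⟨[η], P⟩ = −Tr(c_P · exp*_d(η) · c)`.

So on the tree's objects Kato's explicit reciprocity law at a completion is reduced to the membership of the two elements
`p^N (c_L⁻¹ ∫_{v₁}η · b_ω − ∫_{v₁}ω · c_L⁻¹ b_η)` (`i = 0, 1`) in `X⁰₂ + Fil² ⊂ B_dR⁺` — Kato II Lemma 1.4.3 / BK Ex. 3.11 for the Legendre resolution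
(memo §2, §7.3: these are periods of `∧²` of the Kummer extension, on which φ = p). BSD / K★ (`stmt-BirchSwinnertonDyer-22226`) / [REC] are NOT proved by
this file; (K₂) is the research residue.

## References
* K. Kato, LNM 1553 (1993), Ch. II §1.2.4–1.2.5, Thm. 1.4.1, Lemma 1.4.3. [Kato1993LNM1553]
* S. Bloch, K. Kato (1990), Example 3.11. [BlochKato1990]
* J.-P. Serre, *Abelian ℓ-adic representations* (1968), Ch. I §1.1 (`T_ℓ` free of finite rank, continuous action). [Serre1968]
-/

noncomputable section

open Field Function ValuativeRel WittVector NumberField IsDedekindDomain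
open scoped NumberField Topology

namespace Literature.NumberTheory.PAdicHodge

open Literature.NumberTheory.GaloisRepresentations
open Literature.NumberTheory.GaloisRepresentations.IsNonarchimedeanLocalField
open Literature.NumberTheory.GaloisCohomology
open Literature.NumberTheory.EllipticCurves
open Literature.NumberTheory.PAdicHodge.GaloisContinuity
open Literature.IUT.LogVolume
open _root_.WeierstrassCurve

/-! ### §1 Continuous coordinates of a continuous cocycle on a `ℤ_p`-basis of `T_pW` -/

section Coordinates

variable {K₀ : Type} [Field K₀] [CharZero K₀] (W : WeierstrassCurve K₀) [W.IsElliptic] (F : Type) [Field F] [Algebra K₀ F]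
  (p : ℕ) [Fact p.Prime]

omit [CharZero K₀] in
/-- **Continuous coordinates of a continuous cocycle.** For a `ℤ_p`-basis `b` of `T_pW` and `η ∈ Z¹_cont(Γ_F, T_pW|_{Γ_F})`, the coordinate
functions `cᵢ(σ) = (b.repr (η σ)) i` are continuous, vanish at `σ = 1`, and `η σ = Σᵢ cᵢ(σ) • b i`. (`T_pW` is finitely generated over `ℤ_p`
and its profinite topology is the `ℤ_p`-module topology, so `ℤ_p`-linear functionals are continuous.) [cite: Serre1968, Ch. I §1.1] -/
theorem exists_continuous_coordinates {ι : Type*} [Fintype ι] (b : Module.Basis ι ℤ_[p] (W.tateModule p))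
    (η : contOneCocycles (restrictedTateRep W F p).toTopRep) :
    ∃ c : ι → absoluteGaloisGroup F → ℤ_[p], (∀ i, Continuous (c i)) ∧ (∀ i, c i 1 = 0) ∧ ∀ σ, η.1 σ = ∑ i, c i σ • b i := by
  haveI := module_finite_tateModule_holds W p
  haveI := TateModule.isModuleTopology (A := geomPoints W) (p := p)
  haveI := TateModule.continuousSMul_padicInt (A := geomPoints W) (p := p)
  refine ⟨fun i σ => b.repr (η.1 σ) i, fun i => ?_, fun i => ?_, fun σ => (b.sum_repr (η.1 σ)).symm⟩
  · exact (IsModuleTopology.continuous_of_linearMap (b.coord i)).comp η.1.continuous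
  · change b.repr (η.1 1) i = 0
    rw [contOneCocycles.apply_one, map_zero, Finsupp.zero_apply]

end Coordinates

/-! ### §2 The capstone with (K₂) in basis form -/

section Completion

variable {K : Type} [Field K] [NumberField K] {p : ℕ} [hprime : Fact p.Prime] (v : HeightOneSpectrum (𝓞 K))
  [CharZero (v.adicCompletion K)] [LocallyCompactSpace (absoluteGaloisGroup (v.adicCompletion K))]
  [Fact (¬ IsUnit (p : integerC (v.adicCompletion K)))]
  [IsAdicComplete (Ideal.span {(p : integerC (v.adicCompletion K))}) (integerC (v.adicCompletion K))]
  {K₀ : Type} [Field K₀] [CharZero K₀] (W : WeierstrassCurve K₀) [W.IsElliptic] [Algebra K₀ (v.adicCompletion K)]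
  (e : (k : ℕ) → geomTorsion W ((p ^ k : ℕ) : ℤ) → geomTorsion W ((p ^ k : ℕ) : ℤ) → AlgebraicClosure K₀)
  (hμ : ∀ k S T, e k S T ^ (p ^ k) = 1) (hadd₁ : ∀ k S₁ S₂ T, e k (S₁ + S₂) T = e k S₁ T * e k S₂ T)
  (hadd₂ : ∀ k S T₁ T₂, e k S (T₁ + T₂) = e k S T₁ * e k S T₂)
  (hgal : ∀ k (σ : absoluteGaloisGroup K₀) (S T : geomTorsion W ((p ^ k : ℕ) : ℤ)), σ • e k S T = e k (σ • S) (σ • T))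
  (hcompat : ∀ k (S T : geomTorsion W ((p ^ (k + 1) : ℕ) : ℤ)),
    e k (torsionMulHom W (p ^ (k + 1)) (p ^ k) p (pow_succ p k).symm S)
      (torsionMulHom W (p ^ (k + 1)) (p ^ k) p (pow_succ p k).symm T) = e (k + 1) S T ^ p)

set_option maxHeartbeats 800000 in
include hgal in
/-- ★★ **Kato's explicit reciprocity law at a completion, modulo (K₂) in BASIS FORM.** Setting and conclusion of
`exists_const_tatePairingPoint_eq_neg_trace_of_KTwo` verbatim, but the hypothesis (K₂) on the rescaled Legendre resolution
`x̃(a) = c_L⁻¹Pη(a)·b_ω − Pω(a)·c_L⁻¹b_η` is asked ONLY ON A `ℤ_p`-BASIS `b` of `T_pW`: `∀ i, p^N x̃(b i) ∈ X⁰₂ + Fil²` (`IsTeichLog 2`). The cochain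
form `hX` and the smallness `hXsmall` follow from `LegendreResolutionCoordinates` with the continuous coordinates of `η` (§1).
[cite: Kato1993LNM1553, Ch. II Thm. 1.4.1 (3)–(4), §1.2.4–1.2.5, Lemma 1.4.3] [cite: BlochKato1990, Example 3.11] [cite: Serre1968, Ch. I §1.1] -/
theorem exists_const_tatePairingPoint_eq_neg_trace_of_KTwoBasis
    (hpv : valuation (v.adicCompletion K) (p : v.adicCompletion K) < 1)
    (hF : Function.Surjective (fontaineTheta (integerC (v.adicCompletion K)) p))
    (ψ : C(absoluteGaloisGroup (v.adicCompletion K), ℤ_[p])) (hψ : ∀ σ τ, ψ (σ * τ) = ψ σ + ψ τ)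
    (hψlog : ∀ τ, (ψ τ : ℚ_[p]) = logCyclotomic (F := v.adicCompletion K) p τ)
    {Pω Pη : W.tateModule p →+ BdRPlusTop (v.adicCompletion K) p}
    (hPωZ : ∀ (c : ℤ_[p]) (a : W.tateModule p), Pω (c • a) = BdRPlusTop.of (v.adicCompletion K) p (qpToBdR (c : ℚ_[p])) * Pω a)
    (hPηZ : ∀ (c : ℤ_[p]) (a : W.tateModule p), Pη (c • a) = BdRPlusTop.of (v.adicCompletion K) p (qpToBdR (c : ℚ_[p])) * Pη a)
    (hPω : ∀ (σ : absoluteGaloisGroup (v.adicCompletion K)) (a : W.tateModule p),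
      BdRPlusTop.gal (v.adicCompletion K) p σ (Pω a) = Pω (restrictedTateRep W (v.adicCompletion K) p σ a))
    (hPη : ∀ (σ : absoluteGaloisGroup (v.adicCompletion K)) (a : W.tateModule p),
      BdRPlusTop.gal (v.adicCompletion K) p σ (Pη a) = Pη (restrictedTateRep W (v.adicCompletion K) p σ a))
    (hfil : ∀ a, Pω a ∈ (BdRPlusTop.filOne (v.adicCompletion K) p).toIdeal) (hne : ∃ a, Pω a ≠ 0)
    (hnot : ∃ a, Pη a ∉ (BdRPlusTop.filOne (v.adicCompletion K) p).toIdeal)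
    (heL : ∀ (c : ℤ_[p]) (S U : W.tateModule p), (weilContPairingPadic W (v.adicCompletion K) p e hμ hadd₁ hadd₂ hgal hcompat).toLin (c • S) U =
      twistHom (v.adicCompletion K) p ((weilContPairingPadic W (v.adicCompletion K) p e hμ hadd₁ hadd₂ hgal hcompat).toLin S U) c)
    (healt : ∀ S : W.tateModule p, (weilContPairingPadic W (v.adicCompletion K) p e hμ hadd₁ hadd₂ hgal hcompat).toLin S S = 0)
    (henondeg : ∀ S : W.tateModule p,
      (∀ U, (weilContPairingPadic W (v.adicCompletion K) p e hμ hadd₁ hadd₂ hgal hcompat).toLin S U = 0) → S = 0)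
    (hinj : letI := LocalField.padicAlgebra (v.adicCompletion K) p hpv
      (bdRPeriodRingData (F := v.adicCompletion K) (p := p) hpv).CupLogInjective (logCyclotomic p) (restrictedRationalTateRep W (v.adicCompletion K) p))
    (hde : letI := LocalField.padicAlgebra (v.adicCompletion K) p hpv
      ∀ η : contOneCocycles (restrictedTateRep W (v.adicCompletion K) p).toTopRep,
        (bdRPeriodRingData (F := v.adicCompletion K) (p := p) hpv).HasDualExp (logCyclotomic p) (restrictedRationalTateRep W (v.adicCompletion K) p)
          fun σ => TateModule.toRational p (η.1 σ))
    (d : letI := LocalField.padicAlgebra (v.adicCompletion K) p hpv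
      (bdRPeriodRingData (F := v.adicCompletion K) (p := p) hpv).FilZeroLine (restrictedRationalTateRep W (v.adicCompletion K) p)) :
    letI := LocalField.padicAlgebra (v.adicCompletion K) p hpv
    ∃ (cL c : v.adicCompletion K), cL ≠ 0 ∧
      (∀ S U : W.tateModule p, Pω S * Pη U - Pη S * Pω U = BdRPlusTop.of (v.adicCompletion K) p (embBdRHom hpv hF cL) *
        BdRPlusTop.periodLine (v.adicCompletion K) p ((weilContPairingPadic W (v.adicCompletion K) p e hμ hadd₁ hadd₂ hgal hcompat).toLin S U)) ∧
      ∀ (η κ : contOneCocycles (restrictedTateRep W (v.adicCompletion K) p).toTopRep) (P : (W.baseChange (v.adicCompletion K)).toAffine.Point),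
        (∀ j, (cohomologyMap (tateProjMor W (v.adicCompletion K) p j) 1).hom (oneCocycleClass _ κ) = kummerLevelClass W (v.adicCompletion K) p j P) →
        ∀ (bω bη : BdRPlusTop (v.adicCompletion K) p) (cP : v.adicCompletion K),
          (∀ τ, Pω (κ.1 τ) = BdRPlusTop.gal (v.adicCompletion K) p τ bω - bω) → (∀ τ, Pη (κ.1 τ) = BdRPlusTop.gal (v.adicCompletion K) p τ bη - bη) →
          thetaBdR ((BdRPlusTop.of (v.adicCompletion K) p).symm bω) = algebraMap (v.adicCompletion K) (CompletedAlgClosure (v.adicCompletion K)) cP →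
          ∀ (N : ℕ) {ι : Type} [Fintype ι] (b : Module.Basis ι ℤ_[p] (W.tateModule p)),
            (∀ i, IsTeichLog 2 ((BdRPlusTop.of (v.adicCompletion K) p).symm ((p : BdRPlusTop (v.adicCompletion K) p) ^ N *
              (BdRPlusTop.of (v.adicCompletion K) p (embBdRHom hpv hF cL⁻¹) * Pη (b i) * bω -
                Pω (b i) * (BdRPlusTop.of (v.adicCompletion K) p (embBdRHom hpv hF cL⁻¹) * bη))))) →
            ((tatePairingPoint W (v.adicCompletion K) p e hμ hadd₁ hadd₂ hgal hcompat (oneCocycleClass _ η) P : ℤ_[p]) : ℚ_[p]) =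
              -Algebra.trace ℚ_[p] (v.adicCompletion K) (cP * (expStarCoord W hpv d η * c)) := by
  letI := LocalField.padicAlgebra (v.adicCompletion K) p hpv
  obtain ⟨cL, c, hcL, hLeg, hmain⟩ := exists_const_tatePairingPoint_eq_neg_trace_of_KTwo v W e hμ hadd₁ hadd₂ hgal hcompat hpv hF ψ hψ hψlog
    hPωZ hPηZ hPω hPη hfil hne hnot heL healt henondeg hinj hde d
  refine ⟨cL, c, hcL, hLeg, fun η κ P hκ bω bη cP hbω hbη hθb N ι _ b hKb => hmain η κ P hκ bω bη cP hbω hbη hθb N ?_ ?_⟩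
  -- the rescaled `Pη' = c_L⁻¹ Pη`, `bη' = c_L⁻¹ b_η`: the resolution in the capstone is `Pη'(a) b_ω − Pω(a) bη'`
  all_goals
    obtain ⟨r, hr⟩ : ∃ r : BdRPlusTop (v.adicCompletion K) p, r = BdRPlusTop.of (v.adicCompletion K) p (embBdRHom hpv hF cL⁻¹) := ⟨_, rfl⟩
    obtain ⟨Pη', hPη'app⟩ : ∃ Pη' : W.tateModule p →+ BdRPlusTop (v.adicCompletion K) p, ∀ a, Pη' a = r * Pη a :=
      ⟨(AddMonoidHom.mulLeft r).comp Pη, fun _ => rfl⟩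
    have hPη'Z : ∀ (c : ℤ_[p]) (a : W.tateModule p), Pη' (c • a) = BdRPlusTop.of (v.adicCompletion K) p (qpToBdR (c : ℚ_[p])) * Pη' a :=
      fun c a => by rw [hPη'app, hPη'app, hPηZ, mul_left_comm]
    have hres : ∀ a, r * Pη a * bω - Pω a * (r * bη) = Pη' a * bω - Pω a * (r * bη) := fun a => by rw [hPη'app]
    obtain ⟨co, hco, hco1, hsum⟩ := exists_continuous_coordinates W (v.adicCompletion K) p b η
    have hKb' : ∀ i, IsTeichLog 2 ((BdRPlusTop.of (v.adicCompletion K) p).symm ((p : BdRPlusTop (v.adicCompletion K) p) ^ N *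
        (Pη' (b i) * bω - Pω (b i) * (r * bη)))) := fun i => by rw [← hres, hr]; exact hKb i
  · intro σ
    rw [← hr, hres]
    exact BdRPlusTop.isTeichLog_resolution_of_coordinates W hPωZ hPη'Z (fun i => b i) co (fun σ => η.1 σ) hsum bω (r * bη) hKb' σ
  · intro M'
    simp only [← hr, hres]
    exact BdRPlusTop.eventually_resolution_small_of_coordinates W hPωZ hPη'Z (fun i => b i) co hco hco1 (fun σ => η.1 σ) hsum bω (r * bη)
      hKb' M'

end Completion

end Literature.NumberTheory.PAdicHodge

end
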